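import Summits.BirchSwinnertonDyer.BirchSwinnertonDyer.Theorems.SignedLowerHalvesSmallImageLowerHalfBothSignsRttCharRoadE1OfCountPi
import Literature.NumberTheory.EllipticCurves.GreenbergSelmerDualDataExistsProofs
import Literature.NumberTheory.EllipticCurves.SelmerProofs
import Literature.NumberTheory.GaloisRepresentations.HeckeCharacterProofs
import Literature.NumberTheory.GaloisRepresentations.DecompositionGroupOfCompletion
import HarnessLib

/-!
# Route `SignedLowerHalves`, crux L `SmallImageLowerHalfBothSigns` (stmt-BirchSwinnertonDyer-23599), line `rtt_w3` v12 — glue INPUT (I5), the GENERIC θ-SIDE FACTS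
# of the LEAD's composition `injTop_of_inputs` (INPUT SPEC 10:26:53Z) for `M := GreenbergSelmer.Cofree θ (padicCoeffField S)`, `R := padicCoeffIntegers S`:
# `hMc` (continuity of the `Γ_K`-orbits), `hdiv` (`π`-divisibility), `hπp` (`π • m = 0 ⇒ p • m = 0` for an irreducible `π`), `htriv` (the inertia of a layer
# at a place `v ∉ S₀K`, `v ∤ p` acts trivially: `θ` is unramified off `p𝔪` by the stub's `hθ`, and the `𝔪`-places lie in `S₀K` by `hbad`/`hS₀bad`).

Width seat `bsd-line-slh-p3-w3` g18 under LEAD `cruxlead-stmt-BirchSwinnertonDyer-23599` (cell `bsd-ssimc`; `--supports stmt-BirchSwinnertonDyer-23599 --as helper`).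
THEOREMS ONLY (no definition, no named fact, no instance, no `sorry`). BSD / crux L / INJ_top are NOT proved here. (`hH0`, `hsS` of (I5) are NOT in this file: they
rest on E1-a and the local character identity, next file.)

* `continuous_smul_cofree` (= `hMc`), `exists_smul_eq_cofree` (= `hdiv`), `natCast_mem_span_singleton_of_irreducible` + `nsmul_eq_zero_of_smul_eq_zero_of_irreducible`
  (= `hπp`), `smul_cofree_eq_of_apply_eq_one`, `inertiaIn_smul_cofree_eq`, `not_le_of_not_mem_placesAbove`, ★ `inertiaIn_layerSubgroup_smul_cofree_eq` (= `htriv` VERBATIM).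

References: [Greenberg1989] §1 p. 98; [EmertonPollackWeston2006] §3.1; [SerreLocalFields1979] II §3; [NeukirchANT1999] II (9.6); [SerreAbelianLadic1968] I §2.1.
-/

set_option autoImplicit false
set_option linter.dupNamespace false -- D-0017: single-problem summit, the namespace repeats the problem name by design
noncomputable section

open scoped Classical

namespace Summit.BirchSwinnertonDyer.BirchSwinnertonDyer.Theorems.SmallImageCharSignedSelmer

open NumberField IsDedekindDomain Field Rat.HeightOneSpectrum
  Literature.NumberTheory.EllipticCurves Literature.NumberTheory.EllipticCurves.GreenbergSelmer
  Literature.NumberTheory.GaloisRepresentations WeierstrassCurve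

/-! ## §1 `Cofree θ`: continuity, divisibility, `π`-torsion is `p`-torsion -/

section Cofree

variable {K : Type} [Field K] {p : ℕ} [Fact p.Prime] {S : Set (PadicAlgCl p)} {n : ℕ}
  (θ : FramedGaloisRep K (padicCoeffIntegers S) n)

/-- `hMc`: the `Γ_K`-orbit maps of `A_θ = Fⁿ/𝒪ⁿ` are continuous (open stabilisers, tree `isOpen_stabilizer_cofree`). [cite: Greenberg1989, §1 p. 98] -/
theorem continuous_smul_cofree (m : Cofree θ (padicCoeffField S)) : Continuous fun g : absoluteGaloisGroup K ↦ g • m :=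
  continuous_smul_of_isOpen_stabilizer m (isOpen_stabilizer_cofree S θ m)

/-- `hdiv`: `A_θ` is divisible by every non-zero scalar `π ∈ 𝒪` (`F` is a field). [cite: Greenberg1989, §1 p. 98] -/
theorem exists_smul_eq_cofree {π : padicCoeffIntegers S} (hπ : π ≠ 0) (m : Cofree θ (padicCoeffField S)) :
    ∃ m' : Cofree θ (padicCoeffField S), π • m' = m := by
  obtain ⟨x, rfl⟩ := cofreeMk_surjective (padicCoeffField S) θ m
  have hπF : (algebraMap (padicCoeffIntegers S) (padicCoeffField S) π) ≠ 0 := fun h ↦ hπ (Subtype.ext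
    (show ((π : padicCoeffIntegers S) : PadicAlgCl p) = ((0 : padicCoeffIntegers S) : PadicAlgCl p) from
      congrArg (fun x : padicCoeffField S ↦ (x : PadicAlgCl p)) h))
  refine ⟨cofreeMk (padicCoeffField S) θ ((algebraMap (padicCoeffIntegers S) (padicCoeffField S) π)⁻¹ • x), ?_⟩
  rw [← map_smul, ← algebraMap_smul (padicCoeffField S) π, smul_smul, mul_inv_cancel₀ hπF, one_smul]

/-- In `𝒪 = 𝒪_{ℚ_p(S)}` (a discrete valuation ring) every irreducible `π` divides `p`. [cite: SerreLocalFields1979, II §3] -/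
theorem natCast_mem_span_singleton_of_irreducible [FiniteDimensional ℚ_[p] (padicCoeffField S)] {π : padicCoeffIntegers S} (hπ : Irreducible π) :
    ((p : ℕ) : padicCoeffIntegers S) ∈ Ideal.span {π} := by
  haveI : IsDiscreteValuationRing (padicCoeffIntegers S) := by
    rw [padicCoeffIntegers_eq_unitBall S]
    exact LambdaLowerBoundO.isDiscreteValuationRing_unitBall p (padicCoeffField S)
  rw [← (IsDiscreteValuationRing.irreducible_iff_uniformizer π).1 hπ]
  have h : ¬ IsUnit ((p : ℕ) : padicCoeffIntegers S) := by
    have h' := Literature.NumberTheory.Automorphic.PadicIntermediateField.not_isUnit_natCast_prime p (padicCoeffField S)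
    rw [← padicCoeffIntegers_eq_unitBall S] at h'
    exact h'
  exact (IsLocalRing.mem_maximalIdeal _).2 h

/-- `hπp`: on any `𝒪`-module, `π • m = 0 ⇒ p • m = 0` for an irreducible `π` (`p ∈ (π)`). [cite: SerreLocalFields1979, II §3] -/
theorem nsmul_eq_zero_of_smul_eq_zero_of_irreducible [FiniteDimensional ℚ_[p] (padicCoeffField S)] {π : padicCoeffIntegers S} (hπ : Irreducible π)
    {M : Type*} [AddCommGroup M] [Module (padicCoeffIntegers S) M] {m : M} (hm : π • m = 0) : p • m = 0 := by
  obtain ⟨a, ha⟩ := Ideal.mem_span_singleton'.1 (natCast_mem_span_singleton_of_irreducible (S := S) hπ)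
  rw [← Nat.cast_smul_eq_nsmul (padicCoeffIntegers S), ← ha, mul_smul, hm, smul_zero]

/-- An element of `Γ_K` on which `θ` is trivial acts trivially on `A_θ`. [folklore] -/
theorem smul_cofree_eq_of_apply_eq_one {σ : absoluteGaloisGroup K} (hσ : θ σ = 1) (m : Cofree θ (padicCoeffField S)) : σ • m = m := by
  obtain ⟨x, rfl⟩ := cofreeMk_surjective (padicCoeffField S) θ m
  rw [smul_cofreeMk, fracRepresentation_apply_apply, hσ, Units.val_one, Matrix.map_one _ (map_zero _) (map_one _), Matrix.one_mulVec]

/-- **The inertia of `K̄^H` at a place where `θ` is unramified acts trivially on `A_θ`** (`GreenbergSelmer.inertia v = I_{𝔓₀(v)}`, tree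
`inertia_adicCompletionPrime_eq_map_absInertia`). [cite: SerreAbelianLadic1968, I §2.1] [cite: NeukirchANT1999, Ch. II §9 Prop. (9.6)] -/
theorem inertiaIn_smul_cofree_eq [NumberField K] {v : HeightOneSpectrum (𝓞 K)} (hθv : θ.IsUnramifiedAt v) (H : Subgroup (absoluteGaloisGroup K))
    (x : GreenbergSelmer.inertiaIn H v) (m : Cofree θ (padicCoeffField S)) : x • m = m := by
  have hx : ((x : GreenbergSelmer.decomp (K := K) v) : absoluteGaloisGroup K) ∈ GreenbergSelmer.inertia v :=
    ((GreenbergSelmer.mem_inertiaIn_iff H v _).1 x.2).2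
  have e : GreenbergSelmer.inertia v = (adicCompletionPrime K v).inertia (absoluteGaloisGroup K) :=
    (inertia_adicCompletionPrime_eq_map_absInertia K v).symm
  rw [e] at hx
  exact smul_cofree_eq_of_apply_eq_one θ (hθv _ (adicCompletionPrime_mem_primesAbove K v) _ hx) m

end Cofree

/-! ## §2 `htriv`: the places outside `S₀K ∪ {w ∣ p}` avoid `𝔪` -/

section Triv

variable {K : Type} [Field K] [NumberField K] {p : ℕ} [Fact p.Prime] {S : Set (PadicAlgCl p)}
  (W : WeierstrassCurve ℚ) (𝔪 : Ideal (𝓞 K))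
  (hbad : ∀ (ℓ : ℕ) [Fact ℓ.Prime], ℓ ∣ (NumberField.discr K).natAbs * Ideal.absNorm 𝔪 → ¬ W.HasGoodReductionAtPrime ℓ)
  (S₀ : Finset (HeightOneSpectrum (𝓞 ℚ))) (hS₀bad : ∀ v : HeightOneSpectrum (𝓞 ℚ), ¬ W.HasGoodReductionAt v → v ∈ S₀)

include hbad hS₀bad in
/-- A place `w ∉ S₀K` does not divide `𝔪` (`N𝔪 ∈ 𝔪 ≤ w` would put the prime `ℓ` under `w` in `d_K · N𝔪`, hence bad by `hbad`, hence its place in `S₀` by `hS₀bad`,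
hence `w ∈ S₀K`). [folklore] -/
theorem not_le_of_not_mem_placesAbove {w : HeightOneSpectrum (𝓞 K)}
    (hw : w ∉ {w' : HeightOneSpectrum (𝓞 K) | ∃ v ∈ S₀, ((natGenerator v : ℕ) : 𝓞 K) ∈ w'.asIdeal}) : ¬ 𝔪 ≤ w.asIdeal := by
  intro hle
  set u : HeightOneSpectrum (𝓞 ℚ) := w.under (𝓞 ℚ) with hu
  have h1 : ((Ideal.absNorm 𝔪 : ℕ) : 𝓞 K) ∈ w.asIdeal := hle (Ideal.absNorm_mem 𝔪)
  have h2 : ((Ideal.absNorm 𝔪 : ℕ) : 𝓞 ℚ) ∈ u.asIdeal := by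
    rw [hu, HeightOneSpectrum.under_asIdeal, Ideal.mem_comap, map_natCast]; exact h1
  have h3 : natGenerator u ∣ Ideal.absNorm 𝔪 := (Rat.natCast_mem_asIdeal_iff u).1 h2
  haveI : Fact (natGenerator u).Prime := ⟨prime_natGenerator u⟩
  have hbadu : ¬ W.HasGoodReductionAtPrime (natGenerator u) := hbad (natGenerator u) (dvd_mul_of_dvd_right h3 _)
  have hbadu' : ¬ W.HasGoodReductionAt u := fun h ↦ hbadu ((W.hasGoodReductionAtPrime_iff_hasGoodReductionAt_ringOfIntegers u).2 h)
  exact hw ⟨u, hS₀bad u hbadu', (under_eq_iff_natCast_primesEquiv_mem w u).1 rfl⟩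

include hbad hS₀bad in
/-- ★ **`htriv` (INPUT (I5)).** For `θ` unramified off `p𝔪` (the stub's `hθ`, first conjunct) and any `ℤ_p`-extension `κK` of `K`: at every place `v ∉ S₀K` with `v ∤ p`,
the inertia of the layer `K̄^{κK.layerSubgroup n}` acts trivially on `A_θ`. [cite: SerreAbelianLadic1968, I §2.1] [cite: GreenbergVatsal2000, §2 p. 17] -/
theorem inertiaIn_layerSubgroup_smul_cofree_eq (θ : FramedGaloisRep K (padicCoeffIntegers S) 1)
    (hθ : ∀ w : HeightOneSpectrum (𝓞 K), (p : 𝓞 K) ∉ w.asIdeal → ¬ 𝔪 ≤ w.asIdeal → θ.IsUnramifiedAt w)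
    (κK : ZpExtension K p) (n : ℕ) (v : HeightOneSpectrum (𝓞 K))
    (hv : v ∉ {w' : HeightOneSpectrum (𝓞 K) | ∃ u ∈ S₀, ((natGenerator u : ℕ) : 𝓞 K) ∈ w'.asIdeal}) (hpv : ((p : ℕ) : 𝓞 K) ∉ v.asIdeal)
    (x : GreenbergSelmer.inertiaIn (κK.layerSubgroup n) v) (m : Cofree θ (padicCoeffField S)) : x • m = m :=
  inertiaIn_smul_cofree_eq θ (hθ v hpv (not_le_of_not_mem_placesAbove W 𝔪 hbad S₀ hS₀bad hv)) _ x m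

end Triv

end Summit.BirchSwinnertonDyer.BirchSwinnertonDyer.Theorems.SmallImageCharSignedSelmer

end
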